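import Summits.AtomisticToContinuum.Crystallization.Theorems.FrustratedLawDichotomyCellArithNashIntFlat

/-!
# FrustratedLawDichotomy · crux `AperiodicFrustratedLawGap` (stmt-AtomisticToContinuum-27623) — CELL-ARITH, the host-force PAIRING column
# `hf` in the flat all-integer currency (decomp-a2c hand-1 g53; critic r1796 (B): «the hf pairings (|MI|·|B(L_h)| ≈ 3e5 terms) get the same
# integer fusion inside (b′)»)

One pairing term of (251)'s `hhf` column is `ψ(g(a_z, a_z))·g(a_z, ω)` ((252) `inner_posL_sum_ljBondForce`) with `a_z = (hn/hd)·z` the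
label difference and `ω = w/D` the interior multiplier; with the class reading `PL ≤ S·ψ ≤ PH` and the integer bilinear enclosure
`ed·Γ ∈ [ed·(z·w) − en·|z|₁|w|₁, ed·(z·w) + en·|z|₁|w|₁]` (`…CellArithNashInt.gram_int_mem`) the term at scale `Σ_h := S·D·ed·hd` is
`hn·(S·ψ)·(ed·Γ)` — four corner products and one sign branch, ≈ 15 `ℤ` operations, NO `ℚ`, NO rounding:

* ★ `hfPairIF` (flat: `z0 z1 z2 w0 w1 w2 : ℤ`) + `hfPairIF_mem`;
* ★ `hf_le_int` — the whole (251) `hhf` entry at scale `Σ_h`: `Σ_h·(⟪posL F y, Σ_s g(posL F (a_z s))⟫ + ‖posL F y‖·psiTail δ Lh) ≤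
  Σ_s (hfPairIF …).2 + scHi yb (rdHi Σ_h (psiTailQ δ Lh))` (tail by `…CellArithTails.le_psiTailHiZ`, norm witness `yb`).

Computable `def` (1) + 2 thm; imports `…CellArithNashIntFlat`; 0 sorry.  Tags: [folklore].
-/

namespace Summit.AtomisticToContinuum.Crystallization.Theorems.FrustratedLawDichotomyCellArithHfInt

open scoped BigOperators
open RealInnerProductSpace
open Summit.AtomisticToContinuum.Crystallization.Theorems.FrustratedLawDichotomyCoherentFloorAlgebra (psiT ljBondForce)
open Summit.AtomisticToContinuum.Crystallization.Theorems.FrustratedLawDichotomyCellTails (psiTail)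
open Summit.AtomisticToContinuum.Crystallization.Theorems.FrustratedLawDichotomyCellMetric (posL gram inner_posL_sum_ljBondForce)
open Summit.AtomisticToContinuum.Crystallization.Theorems.FrustratedLawDichotomyCellArith
open Summit.AtomisticToContinuum.Crystallization.Theorems.FrustratedLawDichotomyCellArithTails (psiTailQ le_psiTailHiZ)
open Summit.AtomisticToContinuum.Crystallization.Theorems.FrustratedLawDichotomyCellArithGram (pairLo pairHi le_finsetSum_readings)
open Summit.AtomisticToContinuum.Crystallization.Theorems.FrustratedLawDichotomyCellArithNashInt
  (dotZ l1Z gram_int_mem pairLo_le₂ le_pairHi₂)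
open Summit.AtomisticToContinuum.Crystallization.Theorems.FrustratedLawDichotomyCellArithNashIntFlat (izLoF izHiF izLoF_le le_izHiF)

/-- ★ FLAT integer bounds `(lo, hi)` of `Σ_h·(ψ(g(a_z,a_z))·g(a_z, ω))`, `Σ_h = S·D·ed·hd`, from the class reading `PL PH` of `ψ`, the
integer difference vector `z`, the integer multiplier numerators `w`, `ε = en/ed`, `h = hn/hd`. [folklore] -/
def hfPairIF (PL PH ed en hn z0 z1 z2 w0 w1 w2 : ℤ) : ℤ × ℤ :=
  let d := z0 * w0 + z1 * w1 + z2 * w2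
  let l := ((z0.natAbs + z1.natAbs + z2.natAbs : ℕ) : ℤ) * ((w0.natAbs + w1.natAbs + w2.natAbs : ℕ) : ℤ)
  let gL := ed * d - en * l
  let gH := ed * d + en * l
  let cL := pairLo PL PH gL gH
  let cH := pairHi PL PH gL gH
  (izLoF cL cH hn, izHiF cL cH hn)

section Pair

variable {S D ed en hn hd PL PH : ℤ} {G : Matrix (Fin 3) (Fin 3) ℝ} {ε : ℝ} {z w : Fin 3 → ℤ} {a ω : Fin 3 → ℝ}

/-- ★ `hfPairIF.1 ≤ Σ_h·(ψ(g(a,a))·g(a, ω)) ≤ hfPairIF.2`, `Σ_h = S·D·ed·hd`. [folklore] -/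
theorem hfPairIF_mem (hG : ∀ i j, |G i j - (if i = j then 1 else 0)| ≤ ε) (hε : ε = (en : ℝ) / (ed : ℝ)) (hed : 0 < ed)
    (hD : 0 < D) (hhd : 0 < hd) (ha : ∀ j, a j = (hn : ℝ) / (hd : ℝ) * (z j : ℝ)) (hω : ∀ j, ω j = (w j : ℝ) / (D : ℝ))
    (hPL : (PL : ℝ) ≤ S * psiT (gram G a a)) (hPH : S * psiT (gram G a a) ≤ (PH : ℝ)) :
    (((hfPairIF PL PH ed en hn (z 0) (z 1) (z 2) (w 0) (w 1) (w 2)).1 : ℤ) : ℝ)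
        ≤ ((S * D * ed * hd : ℤ) : ℝ) * (psiT (gram G a a) * gram G a ω)
      ∧ ((S * D * ed * hd : ℤ) : ℝ) * (psiT (gram G a a) * gram G a ω)
        ≤ (((hfPairIF PL PH ed en hn (z 0) (z 1) (z 2) (w 0) (w 1) (w 2)).2 : ℤ) : ℝ) := by
  have hD' : (0 : ℝ) < D := by exact_mod_cast hD
  have hhd' : (0 : ℝ) < hd := by exact_mod_cast hhd
  have hed' : (0 : ℝ) < ed := by exact_mod_cast hed
  obtain ⟨g1, g2⟩ := gram_int_mem hG hed hε z w
  obtain ⟨fd, fl⟩ := Summit.AtomisticToContinuum.Crystallization.Theorems.FrustratedLawDichotomyCellArithNashIntFlat.flat_data z w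
  have eΓ : gram G a ω = (hn : ℝ) / hd / D * gram G (fun i => (z i : ℝ)) (fun j => (w j : ℝ)) := by
    unfold gram; rw [Finset.mul_sum]
    refine Finset.sum_congr rfl fun i _ => ?_
    rw [Finset.mul_sum]
    refine Finset.sum_congr rfl fun j _ => ?_
    rw [ha i, hω j]; field_simp
  have cL := pairLo_le₂ hPL hPH g1 g2
  have cH := le_pairHi₂ hPL hPH g1 g2
  have tL := izLoF_le (c := hn) cL cH
  have tH := le_izHiF (c := hn) cL cH
  have e : ((S * D * ed * hd : ℤ) : ℝ) * (psiT (gram G a a) * gram G a ω)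
      = (S * ed) * ((hn : ℝ) * (psiT (gram G a a) * gram G (fun i => (z i : ℝ)) (fun j => (w j : ℝ)))) := by
    rw [eΓ]; push_cast; field_simp
  unfold hfPairIF
  simp only [fd, fl]
  rw [e]
  exact ⟨tL, tH⟩

end Pair

/-- ★ THE (251) `hhf` ENTRY at scale `Σ_h = S·D·ed·hd` from flat integer pair bounds: for the interior multiplier `y = w/D` (label frame)
and near differences `a_z s = (hn/hd)·z s`, class readings `PL s ≤ S·ψ(g(a_z s, a_z s)) ≤ PH s`, a norm witness `‖posL F y‖ ≤ yb` and
rational `δ, Lh > 0`. [folklore] -/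
theorem hf_le_int {S D ed en hn hd : ℤ} (F : Matrix (Fin 3) (Fin 3) ℝ) {ε : ℝ} {α : Type*} (s : Finset α) (y : Fin 3 → ℝ)
    (az : α → Fin 3 → ℝ) (z : α → Fin 3 → ℤ) (w : Fin 3 → ℤ) (PL PH : α → ℤ) {yb δ Lh : ℚ}
    (hG : ∀ i j, |(F.transpose * F) i j - (if i = j then 1 else 0)| ≤ ε) (hε : ε = (en : ℝ) / (ed : ℝ)) (hed : 0 < ed)
    (hD : 0 < D) (hhd : 0 < hd) (hS : 0 < S) (haz : ∀ a j, az a j = (hn : ℝ) / (hd : ℝ) * (z a j : ℝ))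
    (hy : ∀ j, y j = (w j : ℝ) / (D : ℝ))
    (hw : ∀ a ∈ s, (PL a : ℝ) ≤ S * psiT (gram (F.transpose * F) (az a) (az a))
      ∧ S * psiT (gram (F.transpose * F) (az a) (az a)) ≤ (PH a : ℝ))
    (hyb : ‖posL F y‖ ≤ (yb : ℝ)) (hδ : 0 < δ) (hLh : 0 < Lh) :
    ((S * D * ed * hd : ℤ) : ℝ) * (⟪posL F y, ∑ a ∈ s, ljBondForce (posL F (az a))⟫ + ‖posL F y‖ * psiTail (δ : ℝ) (Lh : ℝ))
      ≤ ((∑ a ∈ s, (hfPairIF (PL a) (PH a) ed en hn (z a 0) (z a 1) (z a 2) (w 0) (w 1) (w 2)).2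
          + scHi yb (rdHi (S * D * ed * hd) (psiTailQ δ Lh)) : ℤ) : ℝ) := by
  have hSg : (0 : ℤ) < S * D * ed * hd := by positivity
  rw [inner_posL_sum_ljBondForce]
  have h1 : ∀ a ∈ s, ((S * D * ed * hd : ℤ) : ℝ) * (psiT (gram (F.transpose * F) (az a) (az a)) * gram (F.transpose * F) y (az a))
      ≤ (((hfPairIF (PL a) (PH a) ed en hn (z a 0) (z a 1) (z a 2) (w 0) (w 1) (w 2)).2 : ℤ) : ℝ) := by
    intro a ha
    obtain ⟨p1, p2⟩ := hw a ha
    have h := (hfPairIF_mem (z := z a) (w := w) hG hε hed hD hhd (haz a) hy p1 p2).2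
    -- symmetry of the Gram form: g(y, az) = g(az, y)
    have hsym : gram (F.transpose * F) y (az a) = gram (F.transpose * F) (az a) y := by
      unfold gram
      rw [Finset.sum_comm]
      refine Finset.sum_congr rfl fun i _ => Finset.sum_congr rfl fun j _ => ?_
      have : (F.transpose * F) j i = (F.transpose * F) i j := by
        simp only [Matrix.mul_apply, Matrix.transpose_apply]; exact Finset.sum_congr rfl fun k _ => mul_comm _ _
      rw [this]; ring
    rw [hsym]; exact h
  have H1 := le_finsetSum_readings (S * D * ed * hd) s _ _ h1
  have hpt := le_psiTailHiZ (S := S * D * ed * hd) δ Lh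
  have hpt0 : 0 ≤ psiTail (δ : ℝ) (Lh : ℝ) := by
    have hδ' : (0 : ℝ) < δ := by exact_mod_cast hδ
    have hL' : (0 : ℝ) < Lh := by exact_mod_cast hLh
    unfold psiTail Summit.AtomisticToContinuum.Crystallization.Theorems.FrustratedLawDichotomyCellTails.S4
      Summit.AtomisticToContinuum.Crystallization.Theorems.FrustratedLawDichotomyCellTails.S10
    positivity
  have hSg' : (0 : ℝ) ≤ ((S * D * ed * hd : ℤ) : ℝ) := by exact_mod_cast hSg.le
  have hy0 : ((S * D * ed * hd : ℤ) : ℝ) * (‖posL F y‖ * psiTail (δ : ℝ) (Lh : ℝ))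
      ≤ ((S * D * ed * hd : ℤ) : ℝ) * ((yb : ℝ) * psiTail (δ : ℝ) (Lh : ℝ)) :=
    mul_le_mul_of_nonneg_left (mul_le_mul_of_nonneg_right hyb hpt0) hSg'
  have hyb0 : 0 ≤ yb := by
    have : (0 : ℝ) ≤ yb := (norm_nonneg _).trans hyb
    exact_mod_cast this
  have H2 := le_scHi (c := yb) hyb0 hpt
  push_cast at H1 H2 hy0 ⊢
  rw [mul_add]
  linarith

end Summit.AtomisticToContinuum.Crystallization.Theorems.FrustratedLawDichotomyCellArithHfInt
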